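import Summits.KontsevichZagierPeriods.KontsevichZagierPeriods.Theorems.FermatIsogenyBetaProductSectorStubTwinDupStepCharts

/-!
# `BetaProductSector` (stmt-KontsevichZagierPeriods-3898), line `registered` (v3) — stub `stub_twinDupStep`,
# part 3: the two laps of the parameter triangle and the ghost chart `(t,m) ↦ (t, P)`

Third part of the twin-duplication move X9. On the parameter triangle `Ω = {(t,m) | 0 < t < m < 1}` the first
Mellin coordinate is `P(t,m) = 4mt/D̂`, `D̂ = m(m-t)² + t(1+m)²`; on every fibre `{m | (t,m) ∈ Ω} = (t,1)` it
takes the same value `4t/(1+t)²` at both ends, increases up to the critical curve `c = 2m³ - tm² - t = 0`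
(`∂P/∂m = -4tc/D̂²`) and decreases afterwards. The two LAPS `Ω₊ = Ω ∩ {c > 0}` and `Ω₋ = Ω ∩ {c < 0}`
therefore have the same image under the GHOST CHART `(t,m) ↦ (t, P(t,m))` (`TwinDupStep.exists_chartPi`:
rational, `det = -4tc/D̂²`, injective on each lap, equal images by the intermediate value theorem); all of this
follows from the chord identity `m₁D̂(t,m₂) - m₂D̂(t,m₁) = (m₁-m₂)·S`, `S = t(1+m₁m₂) - m₁m₂(m₁+m₂)`, a
polynomial decreasing in each argument with `S(m,m) = -c(m)`. This is the branch-exchange mechanism of the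
move: the two points of `Ω` over one point `(t,P)` are `(n², ns)` for the two POSITIVE roots `s` of one quartic
`s⁴ - αs² + βs + 1` (`-n` its smaller negative root). Everything is proved; no `def`, no named fact.
-/

noncomputable section

open MeasureTheory Set
open Literature.ModelTheory.ExponentialFields (IsSemialgebraic)

namespace Summit.KontsevichZagierPeriods.FermatIsogeny.BetaProductSectorStubs

open Literature.NumberTheory.Transcendental
open Literature.NumberTheory.Transcendental.KZ

namespace TwinDupStep

/-! ## The chord polynomial `S` of the fibre function `m ↦ P(t,m)` -/

/-- The chord identity of the fibre function: `m₁D̂(t,m₂) - m₂D̂(t,m₁) = (m₁-m₂)(t(1+m₁m₂) - m₁m₂(m₁+m₂))`.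
[folklore] -/
theorem fibre_chord (t m₁ m₂ : ℝ) :
    m₁ * (m₂ * (m₂ - t) ^ 2 + t * (1 + m₂) ^ 2) - m₂ * (m₁ * (m₁ - t) ^ 2 + t * (1 + m₁) ^ 2) =
      (m₁ - m₂) * (t * (1 + m₁ * m₂) - m₁ * m₂ * (m₁ + m₂)) := by
  ring

/-- Monotonicity of the chord polynomial in its second argument:
`S(m₁,m₂) - S(m₁,m₁) = m₁(m₂-m₁)(t-m₂-2m₁)`, `S(m₁,m₁) = -c(m₁)`. [folklore] -/
theorem chord_lt {t m₁ m₂ : ℝ} (hm₁ : 0 < m₁) (ht : t < m₁) (h : m₁ < m₂) :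
    t * (1 + m₁ * m₂) - m₁ * m₂ * (m₁ + m₂) < -(2 * m₁ ^ 3 - t * m₁ ^ 2 - t) := by
  have e : t * (1 + m₁ * m₂) - m₁ * m₂ * (m₁ + m₂) - -(2 * m₁ ^ 3 - t * m₁ ^ 2 - t) =
      m₁ * (m₂ - m₁) * (t - m₂ - 2 * m₁) := by ring
  have hneg : m₁ * (m₂ - m₁) * (t - m₂ - 2 * m₁) < 0 :=
    mul_neg_of_pos_of_neg (mul_pos hm₁ (sub_pos.2 h)) (by linarith)
  linarith

/-- Monotonicity of the chord polynomial in its first argument: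
`S(m₁,m₂) - S(m₂,m₂) = m₂(m₁-m₂)(t-m₁-2m₂)`, `S(m₂,m₂) = -c(m₂)`. [folklore] -/
theorem chord_gt {t m₁ m₂ : ℝ} (hm₂ : 0 < m₂) (ht : t < m₁) (h : m₁ < m₂) :
    -(2 * m₂ ^ 3 - t * m₂ ^ 2 - t) < t * (1 + m₁ * m₂) - m₁ * m₂ * (m₁ + m₂) := by
  have e : t * (1 + m₁ * m₂) - m₁ * m₂ * (m₁ + m₂) - -(2 * m₂ ^ 3 - t * m₂ ^ 2 - t) =
      m₂ * (m₁ - m₂) * (t - m₁ - 2 * m₂) := by ring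
  have hpos : 0 < m₂ * (m₁ - m₂) * (t - m₁ - 2 * m₂) := by
    have h1 : m₂ * (m₁ - m₂) < 0 := mul_neg_of_pos_of_neg hm₂ (sub_neg.2 h)
    exact mul_pos_of_neg_of_neg h1 (by linarith)
  linarith

/-- **Injectivity of the fibre function on each lap**: two points of one lap with the same value of `P` coincide.
[folklore] -/
theorem lap_injective {t m₁ m₂ : ℝ} (h₁ : t < m₁) (h₂ : t < m₂) (hm₁ : 0 < m₁) (hm₂ : 0 < m₂)
    (hP : m₁ * (m₂ * (m₂ - t) ^ 2 + t * (1 + m₂) ^ 2) = m₂ * (m₁ * (m₁ - t) ^ 2 + t * (1 + m₁) ^ 2)) :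
    (0 < 2 * m₁ ^ 3 - t * m₁ ^ 2 - t → 0 < 2 * m₂ ^ 3 - t * m₂ ^ 2 - t → m₁ = m₂) ∧
    (2 * m₁ ^ 3 - t * m₁ ^ 2 - t < 0 → 2 * m₂ ^ 3 - t * m₂ ^ 2 - t < 0 → m₁ = m₂) := by
  have e := fibre_chord t m₁ m₂
  rw [hP, sub_self] at e
  have hS : m₁ ≠ m₂ → t * (1 + m₁ * m₂) - m₁ * m₂ * (m₁ + m₂) = 0 := fun hne => by
    rcases mul_eq_zero.1 e.symm with h | h
    · exact absurd (sub_eq_zero.1 h) hne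
    · exact h
  have hsymm : t * (1 + m₂ * m₁) - m₂ * m₁ * (m₂ + m₁) = t * (1 + m₁ * m₂) - m₁ * m₂ * (m₁ + m₂) := by ring
  constructor
  · intro hc₁ hc₂
    by_contra hne
    have h0 := hS hne
    rcases lt_or_gt_of_ne hne with h | h
    · linarith [chord_lt hm₁ h₁ h]
    · have := chord_lt hm₂ h₂ h
      rw [hsymm] at this
      linarith
  · intro hc₁ hc₂
    by_contra hne
    have h0 := hS hne
    rcases lt_or_gt_of_ne hne with h | h
    · linarith [chord_gt hm₂ h₁ h]
    · have := chord_gt hm₁ h₂ h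
      rw [hsymm] at this
      linarith

/-- **Lap exchange by the intermediate value theorem**: for `(t,m₁)` on one lap of `Ω` there is `m₂` on the
other lap with the same value of `P = 4mt/D̂` (a zero of the chord polynomial `S(m₁,·)`). [folklore] -/
theorem lap_exchange {t m₁ : ℝ} (ht : 0 < t) (h₁ : t < m₁) (h₁' : m₁ < 1) :
    (2 * m₁ ^ 3 - t * m₁ ^ 2 - t < 0 → ∃ m₂, (t < m₂ ∧ m₂ < 1) ∧ 0 < 2 * m₂ ^ 3 - t * m₂ ^ 2 - t ∧
      4 * m₂ * t / (m₂ * (m₂ - t) ^ 2 + t * (1 + m₂) ^ 2) = 4 * m₁ * t / (m₁ * (m₁ - t) ^ 2 + t * (1 + m₁) ^ 2)) ∧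
    (0 < 2 * m₁ ^ 3 - t * m₁ ^ 2 - t → ∃ m₂, (t < m₂ ∧ m₂ < 1) ∧ 2 * m₂ ^ 3 - t * m₂ ^ 2 - t < 0 ∧
      4 * m₂ * t / (m₂ * (m₂ - t) ^ 2 + t * (1 + m₂) ^ 2) = 4 * m₁ * t / (m₁ * (m₁ - t) ^ 2 + t * (1 + m₁) ^ 2)) := by
  have hm₁ : 0 < m₁ := lt_trans ht h₁
  set φ : ℝ → ℝ := fun m => t * (1 + m₁ * m) - m₁ * m * (m₁ + m) with hφ
  have hφc : ∀ a b : ℝ, ContinuousOn φ (Set.Icc a b) := fun a b => by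
    apply Continuous.continuousOn
    rw [hφ]
    fun_prop
  have hφ₁ : φ m₁ = -(2 * m₁ ^ 3 - t * m₁ ^ 2 - t) := by rw [hφ]; ring
  -- a zero of the chord polynomial gives a point with the same value of `P`
  have hPeq : ∀ m₂, t < m₂ → m₂ < 1 → φ m₂ = 0 →
      4 * m₂ * t / (m₂ * (m₂ - t) ^ 2 + t * (1 + m₂) ^ 2) = 4 * m₁ * t / (m₁ * (m₁ - t) ^ 2 + t * (1 + m₁) ^ 2) := by
    intro m₂ h₂ h₂' h0
    have hm₂ : 0 < m₂ := lt_trans ht h₂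
    rw [div_eq_div_iff (denomL_pos ht.le hm₂ h₂'.le).ne' (denomL_pos ht.le hm₁ h₁'.le).ne']
    have e := fibre_chord t m₁ m₂
    have h0' : t * (1 + m₁ * m₂) - m₁ * m₂ * (m₁ + m₂) = 0 := h0
    rw [h0', mul_zero, sub_eq_zero] at e
    linear_combination (-4 * t) * e
  constructor
  · intro hc
    have hφ1 : φ 1 < 0 := by
      have e : φ 1 = (1 + m₁) * (t - m₁) := by rw [hφ]; ring
      rw [e]
      exact mul_neg_of_pos_of_neg (by linarith) (by linarith)
    have hmem : (0:ℝ) ∈ Set.Ioo (φ 1) (φ m₁) := ⟨hφ1, by rw [hφ₁]; linarith⟩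
    obtain ⟨m₂, ⟨h₂, h₂'⟩, h0⟩ := intermediate_value_Ioo' h₁'.le (hφc m₁ 1) hmem
    have hm₂ : 0 < m₂ := by linarith
    refine ⟨m₂, ⟨by linarith, h₂'⟩, ?_, hPeq m₂ (by linarith) h₂' h0⟩
    have key := chord_gt hm₂ h₁ h₂
    have h0' : t * (1 + m₁ * m₂) - m₁ * m₂ * (m₁ + m₂) = 0 := h0
    linarith
  · intro hc
    have hφt : 0 < φ t := by
      have e : φ t = t * (1 - m₁ ^ 2) := by rw [hφ]; ring
      rw [e]
      exact mul_pos ht (by nlinarith)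
    have hmem : (0:ℝ) ∈ Set.Ioo (φ m₁) (φ t) := ⟨by rw [hφ₁]; linarith, hφt⟩
    obtain ⟨m₂, ⟨h₂, h₂'⟩, h0⟩ := intermediate_value_Ioo' h₁.le (hφc t m₁) hmem
    have hm₂ : 0 < m₂ := by linarith
    refine ⟨m₂, ⟨h₂, by linarith⟩, ?_, hPeq m₂ h₂ (by linarith) h0⟩
    have key := chord_lt hm₂ h₂ h₂'
    have h0' : t * (1 + m₁ * m₂) - m₁ * m₂ * (m₁ + m₂) = 0 := h0
    have hsymm : t * (1 + m₂ * m₁) - m₂ * m₁ * (m₂ + m₁) = t * (1 + m₁ * m₂) - m₁ * m₂ * (m₁ + m₂) := by ring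
    linarith

/-! ## The ghost chart `(t,m) ↦ (t, P(t,m))` on the two laps -/

/-- The lap `Ω₊ = Ω ∩ {c > 0}` (`c = 2m³ - tm² - t`) is `ℚ`-semialgebraic. [folklore] -/
theorem isSemialgebraic_lapPlus :
    IsSemialgebraic ℚ {z : Fin 2 → ℝ | (0 < z 0 ∧ z 0 < z 1 ∧ z 1 < 1) ∧
      0 < 2 * z 1 ^ 3 - z 0 * z 1 ^ 2 - z 0} := by
  have h := Literature.ModelTheory.ExponentialFields.isSemialgebraic_setOf_eval_pos (k := ℚ) (R := ℝ)
    (2 * MvPolynomial.X 1 ^ 3 - MvPolynomial.X 0 * MvPolynomial.X 1 ^ 2 - MvPolynomial.X 0 :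
      MvPolynomial (Fin 2) ℚ)
  convert QuadStep.isSemialgebraic_wedge.inter h using 1
  ext z
  simp only [mem_setOf_eq, mem_inter_iff, map_sub, map_mul, map_pow, map_ofNat, MvPolynomial.aeval_X]

/-- The lap `Ω₋ = Ω ∩ {c < 0}` is `ℚ`-semialgebraic. [folklore] -/
theorem isSemialgebraic_lapMinus :
    IsSemialgebraic ℚ {z : Fin 2 → ℝ | (0 < z 0 ∧ z 0 < z 1 ∧ z 1 < 1) ∧
      2 * z 1 ^ 3 - z 0 * z 1 ^ 2 - z 0 < 0} := by
  have h := Literature.ModelTheory.ExponentialFields.isSemialgebraic_setOf_eval_pos (k := ℚ) (R := ℝ)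
    (-(2 * MvPolynomial.X 1 ^ 3 - MvPolynomial.X 0 * MvPolynomial.X 1 ^ 2 - MvPolynomial.X 0) :
      MvPolynomial (Fin 2) ℚ)
  convert QuadStep.isSemialgebraic_wedge.inter h using 1
  ext z
  simp only [mem_setOf_eq, mem_inter_iff, map_neg, map_sub, map_mul, map_pow, map_ofNat,
    MvPolynomial.aeval_X, neg_pos]

/-- **The ghost chart `(t,m) ↦ (t, P(t,m))`**, `P = 4mt/D̂`, `D̂ = m(m-t)² + t(1+m)²`, on the two laps
`Ω₊ = Ω ∩ {c > 0}`, `Ω₋ = Ω ∩ {c < 0}` (`c = 2m³ - tm² - t`) of the parameter triangle: a `ℚ`-rational map with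
`det = ∂P/∂m = -4tc/D̂²`, injective on each lap, and the two laps have THE SAME IMAGE (lap exchange).
[folklore] -/
theorem exists_chartPi : ∃ (Φ : (Fin 2 → ℝ) → (Fin 2 → ℝ)) (Φ' : (Fin 2 → ℝ) → (Fin 2 → ℝ) →L[ℝ] (Fin 2 → ℝ)), (∀ z, Φ z 0 = z 0) ∧ (∀ z, Φ z 1 = 4 * z 1 * z 0 / (z 1 * (z 1 - z 0) ^ 2 + z 0 * (1 + z 1) ^ 2)) ∧ Literature.NumberTheory.Transcendental.IsSemialgebraicMapOn ℚ {z : Fin 2 → ℝ | (0 < z 0 ∧ z 0 < z 1 ∧ z 1 < 1) ∧ 0 < 2 * z 1 ^ 3 - z 0 * z 1 ^ 2 - z 0} Φ ∧ Literature.NumberTheory.Transcendental.IsSemialgebraicMapOn ℚ {z : Fin 2 → ℝ | (0 < z 0 ∧ z 0 < z 1 ∧ z 1 < 1) ∧ 2 * z 1 ^ 3 - z 0 * z 1 ^ 2 - z 0 < 0} Φ ∧ (∀ z ∈ {z : Fin 2 → ℝ | 0 < z 0 ∧ z 0 < z 1 ∧ z 1 < 1}, HasFDerivAt Φ (Φ'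 z) z) ∧ Set.InjOn Φ {z : Fin 2 → ℝ | (0 < z 0 ∧ z 0 < z 1 ∧ z 1 < 1) ∧ 0 < 2 * z 1 ^ 3 - z 0 * z 1 ^ 2 - z 0} ∧ Set.InjOn Φ {z : Fin 2 → ℝ | (0 < z 0 ∧ z 0 < z 1 ∧ z 1 < 1) ∧ 2 * z 1 ^ 3 - z 0 * z 1 ^ 2 - z 0 < 0} ∧ Φ '' {z : Fin 2 → ℝ | (0 < z 0 ∧ z 0 < z 1 ∧ z 1 < 1) ∧ 0 < 2 * z 1 ^ 3 - z 0 * z 1 ^ 2 - z 0} = Φ '' {z : Fin 2 → ℝ | (0 < z 0 ∧ z 0 < z 1 ∧ z 1 < 1) ∧ 2 * z 1 ^ 3 - z 0 * z 1 ^ 2 - z 0 < 0} ∧ (∀ z ∈ {z : Fin 2 → ℝ | 0 < z 0 ∧ z 0 < z 1 ∧ z 1 < 1}, (Φ' z).det = -(4 * z 0 * (2 * z 1 ^ 3 - z 0 * z 1 ^ 2 - z 0) / (z 1 * (z 1 - z 0) ^ 2 + z 0 * (1 + z 1) ^ 2) ^ 2)) := by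
  set Φ : (Fin 2 → ℝ) → (Fin 2 → ℝ) :=
    fun z => ![z 0, 4 * z 1 * z 0 / (z 1 * (z 1 - z 0) ^ 2 + z 0 * (1 + z 1) ^ 2)] with hΦ
  set N : (Fin 2 → ℝ) → ℝ := fun z => 4 * z 1 * z 0 with hN
  set D : (Fin 2 → ℝ) → ℝ := fun z => z 1 * (z 1 - z 0) ^ 2 + z 0 * (1 + z 1) ^ 2 with hD
  set d₀ : (Fin 2 → ℝ) → ℝ := fun z => -(2 * z 1 * (z 1 - z 0)) + (1 + z 1) ^ 2 with hd₀
  set d₁ : (Fin 2 → ℝ) → ℝ := fun z => (z 1 - z 0) ^ 2 + 2 * z 1 * (z 1 - z 0) + 2 * z 0 * (1 + z 1) with hd₁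
  set Φ' : (Fin 2 → ℝ) → (Fin 2 → ℝ) →L[ℝ] (Fin 2 → ℝ) := fun z => LinearMap.toContinuousLinearMap
    (Matrix.toLin' !![1, 0; (4 * z 1 * D z - N z * d₀ z) / D z ^ 2, (4 * z 0 * D z - N z * d₁ z) / D z ^ 2])
    with hΦ'
  have hΦ0 : ∀ z, Φ z 0 = z 0 := fun z => rfl
  have hΦ1 : ∀ z, Φ z 1 = 4 * z 1 * z 0 / (z 1 * (z 1 - z 0) ^ 2 + z 0 * (1 + z 1) ^ 2) := fun z => rfl
  have hderiv : ∀ z : Fin 2 → ℝ, D z ≠ 0 → HasFDerivAt Φ (Φ' z) z := by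
    intro z hz
    have h0 := hasFDerivAt_fst_coeff z
    have h1 := hasFDerivAt_snd_coeff z
    have hNd : HasFDerivAt N ((4 * z 1) • ContinuousLinearMap.proj (R := ℝ) (φ := fun _ : Fin 2 => ℝ) 0 +
        (4 * z 0) • ContinuousLinearMap.proj (R := ℝ) (φ := fun _ : Fin 2 => ℝ) 1) z := by
      have h := (h1.const_mul (4:ℝ)).mul h0
      have hf : N = fun w => 4 * w 1 * w 0 := rfl
      rw [hf]
      refine h.congr_fderiv (ContinuousLinearMap.ext fun v => ?_)
      simp
      ring
    have hDd : HasFDerivAt D (d₀ z • ContinuousLinearMap.proj (R := ℝ) (φ := fun _ : Fin 2 => ℝ) 0 +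
        d₁ z • ContinuousLinearMap.proj (R := ℝ) (φ := fun _ : Fin 2 => ℝ) 1) z := by
      have h := (h1.mul ((h1.sub h0).mul (h1.sub h0))).add (h0.mul ((h1.const_add 1).mul (h1.const_add 1)))
      have hf : D = fun w => w 1 * ((w 1 - w 0) * (w 1 - w 0)) + w 0 * ((1 + w 1) * (1 + w 1)) :=
        funext fun w => by rw [hD]; ring
      rw [hf]
      refine h.congr_fderiv (ContinuousLinearMap.ext fun v => ?_)
      simp [hd₀, hd₁]
      ring
    exact hasFDerivAt_chart2 h0 (hasFDerivAt_div_coeff hNd hDd hz)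
  have hdet : ∀ z : Fin 2 → ℝ, D z ≠ 0 →
      (Φ' z).det = -(4 * z 0 * (2 * z 1 ^ 3 - z 0 * z 1 ^ 2 - z 0) / D z ^ 2) := by
    intro z hz
    rw [hΦ', det_chart2]
    field_simp
    rw [hD, hN, hd₁]
    ring
  have hDpos : ∀ z ∈ {z : Fin 2 → ℝ | 0 < z 0 ∧ z 0 < z 1 ∧ z 1 < 1}, 0 < D z :=
    fun z hz => denomL_pos hz.1.le (lt_trans hz.1 hz.2.1) hz.2.2.le
  have hsa : ∀ s : Set (Fin 2 → ℝ), s ⊆ {z : Fin 2 → ℝ | 0 < z 0 ∧ z 0 < z 1 ∧ z 1 < 1} → IsSemialgebraic ℚ s →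
      IsSemialgebraicMapOn ℚ s Φ := by
    intro s hs hss
    refine IsSemialgebraicMapOn.of_forall hss (Fin.forall_fin_two.2 ⟨?_, ?_⟩)
    · exact (isSemialgebraicFunOn_aeval hss (MvPolynomial.X 0 : MvPolynomial (Fin 2) ℚ)).congr
        (fun z _ => by simp [hΦ0])
    · exact (isSemialgebraicFunOn_aeval_div_aeval hss
        (4 * MvPolynomial.X 1 * MvPolynomial.X 0 : MvPolynomial (Fin 2) ℚ)
        (MvPolynomial.X 1 * (MvPolynomial.X 1 - MvPolynomial.X 0) ^ 2 +
          MvPolynomial.X 0 * (1 + MvPolynomial.X 1) ^ 2)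
        (fun x hx => by simpa using (hDpos x (hs hx)).ne')).congr (fun z _ => by simp [hΦ1])
  -- injectivity on a lap from the scalar `lap_injective`
  have hinj : ∀ (pos : Bool), Set.InjOn Φ {z : Fin 2 → ℝ | (0 < z 0 ∧ z 0 < z 1 ∧ z 1 < 1) ∧
      (if pos then 0 < 2 * z 1 ^ 3 - z 0 * z 1 ^ 2 - z 0 else 2 * z 1 ^ 3 - z 0 * z 1 ^ 2 - z 0 < 0)} := by
    intro pos x hx y hy hxy
    simp only [mem_setOf_eq] at hx hy
    have e0 := congrFun hxy 0
    have e1 := congrFun hxy 1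
    simp only [hΦ0, hΦ1] at e0 e1
    rw [e0] at e1 hx
    have hmx : 0 < x 1 := lt_trans hx.1.1 hx.1.2.1
    have hmy : 0 < y 1 := lt_trans hy.1.1 hy.1.2.1
    rw [div_eq_div_iff (denomL_pos hy.1.1.le hmx hx.1.2.2.le).ne' (denomL_pos hy.1.1.le hmy hy.1.2.2.le).ne']
      at e1
    have hP : x 1 * (y 1 * (y 1 - y 0) ^ 2 + y 0 * (1 + y 1) ^ 2) =
        y 1 * (x 1 * (x 1 - y 0) ^ 2 + y 0 * (1 + x 1) ^ 2) := by
      have h4 : (4 * y 0 : ℝ) ≠ 0 := by have := hy.1.1; positivity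
      exact mul_left_cancel₀ h4 (by linear_combination e1)
    have key := lap_injective hx.1.2.1 hy.1.2.1 hmx hmy hP
    have h1 : x 1 = y 1 := by
      cases pos
      · simp only [Bool.false_eq_true, if_false] at hx hy
        exact key.2 hx.2 hy.2
      · simp only [if_true] at hx hy
        exact key.1 hx.2 hy.2
    exact funext (Fin.forall_fin_two.2 ⟨e0, h1⟩)
  refine ⟨Φ, Φ', hΦ0, hΦ1, hsa _ (fun z hz => hz.1) isSemialgebraic_lapPlus,
    hsa _ (fun z hz => hz.1) isSemialgebraic_lapMinus, fun z hz => hderiv z (hDpos z hz).ne', ?_, ?_, ?_,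
    fun z hz => hdet z (hDpos z hz).ne'⟩
  · simpa using hinj true
  · simpa using hinj false
  · ext y
    constructor
    · rintro ⟨z, ⟨hz, hc⟩, rfl⟩
      obtain ⟨m₂, hm₂, hc₂, hP⟩ := (lap_exchange hz.1 hz.2.1 hz.2.2).2 hc
      refine ⟨![z 0, m₂], ⟨⟨hz.1, hm₂.1, hm₂.2⟩, hc₂⟩, funext (Fin.forall_fin_two.2 ⟨rfl, ?_⟩)⟩
      simp only [hΦ1]
      exact hP
    · rintro ⟨z, ⟨hz, hc⟩, rfl⟩
      obtain ⟨m₂, hm₂, hc₂, hP⟩ := (lap_exchange hz.1 hz.2.1 hz.2.2).1 hc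
      refine ⟨![z 0, m₂], ⟨⟨hz.1, hm₂.1, hm₂.2⟩, hc₂⟩, funext (Fin.forall_fin_two.2 ⟨rfl, ?_⟩)⟩
      simp only [hΦ1]
      exact hP

end TwinDupStep

end Summit.KontsevichZagierPeriods.FermatIsogeny.BetaProductSectorStubs

end
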